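import Literature.AnabelianGeometry.SemiGraphs.TemperedAnabelianTowerWitness
import Literature.AnabelianGeometry.SemiGraphs.TemperedProfiniteProducts
import Literature.AnabelianGeometry.SemiGraphs.TemperedDeltaNormalizers
import Literature.NumberTheory.LocalFields.PadicGaloisSecondCountable
import Mathlib.FieldTheory.Galois.Profinite
import HarnessLib

/-!
# Non-vacuity of "tempered + GALOIS-COUNTABLE + virtually free tower" JOINTLY with the [SemiAnbd] §6
# interface, and the §6 `Δ`-completion chain at that witness

Mochizuki, *Semi-graphs of anabelioids*, Publ. RIMS **42** (2006) [SemiAnbd], §6 pp. 69–71, 73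
[cite: MochizukiSemiAnbd2006, §6 pp.69-71]; [IUTchI] Rmk. 2.5.3 (i) (T1) p. 52 ("Galois-countable":
"its topology admits a countable basis").

VACUITY-LANE companion (abc-iut cell, prover abc-iut-L3-t6; theorems only, no definitions, no
instances, no named facts) of abc-iut-w5-d240's `TemperedAnabelianTowerWitnessCurve.lean`.  The
`Δ^temp`-chain of [SemiAnbd] §6 (abc-iut-w5-d139: `TemperedDeltaCompletion` /
`TemperedDeltaTower` / `TemperedDeltaNormalizers`), the open-mapping theorems of
`TemperedOpenMapping.lean` and abc-iut-w5-d240's `Π^temp`-halves of Lem. 6.1 (iii) / 6.3 (iii) all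
quantify over `X : TemperedCurve p` carrying `IsTempered X.PiTemp`, `[FirstCountableTopology X.PiTemp]`
(Galois-countability) and the André tower input `htower₀`.  abc-iut-w5-d240's witness
(`Π^temp := F₂ × G_{ℚ_p}`) certified the first and third; this file adds the second — using the tree's
theorem that `G_{ℚ_p} = Gal(Q̄_p/ℚ_p)` is second countable (`secondCountableTopology_galQp`,
`PadicGaloisSecondCountable.lean`, abc-iut-w5-d040, from Krasner's finiteness theorem
`PadicFiniteSubextensions.lean`) — and records that at this ONE datum every conclusion of the §6
`Δ`-chain holds, so none of those closers quantifies vacuously: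

* `exists_temperedCurve_isTempered_secondCountable_tower` — `∃ X : TemperedCurve p` with
  `IsTempered X.PiTemp ∧ SecondCountableTopology X.PiTemp ∧ ¬ CompactSpace X.PiTemp ∧ htower₀`
  (`K = ℚ_p`, `Π^temp := F₂ × G_{ℚ_p}`, `Π := F̂₂ × G_{ℚ_p}`, no closed points; the construction is
  abc-iut-w5-d240's, verbatim, with the countable basis added);
* `exists_temperedCurve_deltaChain` — `∃ X : TemperedCurve p`, non-compact, at which SIMULTANEOUSLY:
  `aug` is an open map, `Ker(Π_X → G_K) = Δ_X`, `Δ^temp_X ↪ Δ_X` is a profinite completion, Lem. 6.1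
  (ii) `DeltaTempNormallyTerminal`, Lem. 6.1 (iii) `PiTempNormallyTerminal`, Lem. 6.3 (iii) for
  `F = Π^temp` and for `F = Δ^temp`.

HONEST LIMITS: consistency evidence only; `F₂ × G_{ℚ_p}` is not the tempered fundamental group of a
curve, and the parameter bundle `GroupLevelData` (which also asks for slimness of `Π^temp` and an
identification `G_K ≃ Gal(K̄/K)` of a second algebraic closure) is NOT inhabited here.  Nothing here
concerns the disputed parts of inter-universal Teichmüller theory or takes a side on [IUTchIII]
Cor. 3.12; typed ≠ proved.
-/

noncomputable section

namespace Literature.AnabelianGeometry.SemiGraphs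

open CategoryTheory ProfiniteGrp ProfiniteGrp.ProfiniteCompletion
open _root_.Topology

section Curve

variable (p : ℕ) [Fact p.Prime]

/-- **`IsTempered`, Galois-countability (`SecondCountableTopology`) and the tower input `htower₀` are
jointly satisfiable with the axioms of the §6 interface `TemperedCurve p`, by a NON-compact datum**:
`K = ℚ_p`, `Π^temp := F₂ × G_{ℚ_p}` (`F₂` discrete free of rank two — countable, so second countable;
`G_{ℚ_p}` second countable by Krasner's finiteness theorem, `secondCountableTopology_galQp`),
augmentation the second projection, `Π := F̂₂ × G_{ℚ_p}`, no closed points (abc-iut-w5-d240's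
construction with the countable basis added).  Consistency evidence only; not a curve.
[cite: MochizukiSemiAnbd2006, §6 pp.69-71] -/
theorem exists_temperedCurve_isTempered_secondCountable_tower :
    ∃ X : TemperedCurve p, IsTempered X.PiTemp ∧ SecondCountableTopology X.PiTemp ∧
      ¬ CompactSpace X.PiTemp ∧
      ∀ U ∈ 𝓝 (1 : X.PiTemp), ∃ N : OpenNormalSubgroup X.PiTemp, (N : Set X.PiTemp) ⊆ U ∧
        ∃ (G : Subgroup (X.PiTemp ⧸ N.toSubgroup)) (_ : IsFreeGroup G), G.Normal ∧ G.FiniteIndex ∧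
          Finite (IsFreeGroup.Generators G) ∧ ∃ a ∈ G, ∃ b ∈ G, a * b ≠ b * a := by
  -- adapted from abc-iut-w5-d240, TemperedAnabelianTowerWitnessCurve.lean (p422738)
  letI : TopologicalSpace (FreeGroup (Fin 2)) := ⊥
  haveI : DiscreteTopology (FreeGroup (Fin 2)) := ⟨rfl⟩
  haveI : IsTopologicalGroup (FreeGroup (Fin 2)) := ⟨⟩
  haveI : IsGalois ℚ_[p] (AlgebraicClosure ℚ_[p]) := {}
  haveI : T2Space (GQp p) := krullTopology_t2
  haveI : Finite (IsFreeGroup.Generators (FreeGroup (Fin 2))) :=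
    Finite.of_equiv (Fin 2) (Equiv.ofFreeGroupEquiv (IsFreeGroup.toFreeGroup (FreeGroup (Fin 2))))
  haveI : SecondCountableTopology (GQp p) :=
    Literature.NumberTheory.LocalFields.secondCountableTopology_galQp p
  let η : FreeGroup (Fin 2) →ₜ* completion (GrpCat.of (FreeGroup (Fin 2))) :=
    { toMonoidHom := toProfiniteCompletion (FreeGroup (Fin 2))
      continuous_toFun := continuous_of_discreteTopology }
  have hη : IsProfiniteCompletion η := isProfiniteCompletion_toProfiniteCompletion (FreeGroup (Fin 2))
  haveI := Literature.GroupTheory.CombinatorialGroupTheory.freeGroup_residuallyFinite (Fin 2)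
  have hηinj : Function.Injective η := toProfiniteCompletion_injective
  let X : TemperedCurve p :=
    { K := ⊥
      finiteDimensional_K := inferInstance
      PiTemp := FreeGroup (Fin 2) × GQp p
      aug := ContinuousMonoidHom.snd (FreeGroup (Fin 2)) (GQp p)
      range_aug := by
        rw [IntermediateField.fixingSubgroup_bot]
        exact MonoidHom.range_eq_top.mpr Prod.snd_surjective
      PiHat := completion (GrpCat.of (FreeGroup (Fin 2))) × GQp p
      toHat := η.prodMap (ContinuousMonoidHom.id (GQp p))
      isProfiniteCompletion_toHat := hη.prodMap_id
      toHat_injective := hηinj.prodMap Function.injective_id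
      augHat := ContinuousMonoidHom.snd _ (GQp p)
      augHat_comp := fun _ => rfl
      Pt := PEmpty
      IsCusp := fun x => x.elim
      decomp := fun x => x.elim
      isClosed_decomp := fun x => x.elim
      isOpen_aug_decomp := fun x => x.elim
      inertia_eq_bot := fun x => x.elim
      inertia_equiv_zHat := fun x => x.elim }
  have hsc : SecondCountableTopology (FreeGroup (Fin 2) × GQp p) := inferInstance
  refine ⟨X, isTempered_of_discreteTopology.prod_of_profinite, hsc, ?_, tower_prod_of_profinite
    (tower_of_isFreeGroup ⟨FreeGroup.of 0, FreeGroup.of 1, ?_⟩)⟩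
  · -- `F₂ × G_{ℚ_p}` is not compact: its continuous image `F₂` (first projection) would be a compact
    -- discrete, hence finite, group
    intro hc
    have hcomp : IsCompact (Set.univ : Set (FreeGroup (Fin 2))) := by
      have h := (isCompact_univ (X := FreeGroup (Fin 2) × GQp p)).image continuous_fst
      rwa [Set.image_univ, Set.range_eq_univ.mpr Prod.fst_surjective] at h
    haveI : CompactSpace (FreeGroup (Fin 2)) := ⟨hcomp⟩
    haveI : Finite (FreeGroup (Fin 2)) := finite_of_compact_of_discrete
    exact not_finite (FreeGroup (Fin 2))
  · intro h
    let f : FreeGroup (Fin 2) →* Equiv.Perm (Fin 3) :=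
      FreeGroup.lift ![Equiv.swap 0 1, Equiv.swap 1 2]
    have h2 := congrArg f h
    simp only [map_mul, f, FreeGroup.lift_apply_of] at h2
    exact absurd h2 (by decide)

/-- **The [SemiAnbd] §6 `Δ`-completion chain does not quantify vacuously**: there is a (non-compact)
`X : TemperedCurve p` — the datum of `exists_temperedCurve_isTempered_secondCountable_tower` — at which
ALL of the following hold at once: the augmentation `Π^temp_{X_K} → G_{ℚ_p}` is an open map
(`isOpenMap_aug_of_isTempered`); `Ker(Π_X → G_K) = Δ_X` and `Δ^temp_X ↪ Δ_X` is a profinite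
completion (abc-iut-w5-d139, `TemperedDeltaCompletion`); Lem. 6.1 (ii) `N_{Δ_X}(Δ^temp_X) = Δ^temp_X`,
Lem. 6.1 (iii) `N_{Π_X}(Π^temp) = Π^temp`, and Lem. 6.3 (iii) for `F = Π^temp_{X_K}` and for
`F = Δ^temp_X` (abc-iut-w5-d139 / abc-iut-w5-d240, modulo the tower input, which the datum carries).
Consistency evidence only. [cite: MochizukiSemiAnbd2006, Lem 6.1(ii)(iii) p.69, Lem 6.3(iii) p.70] -/
theorem exists_temperedCurve_deltaChain :
    ∃ X : TemperedCurve p, ¬ CompactSpace X.PiTemp ∧ IsOpenMap X.aug ∧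
      X.augHat.toMonoidHom.ker = X.DeltaHat ∧ IsProfiniteCompletion X.deltaToHat ∧
      X.DeltaTempNormallyTerminal ∧ X.PiTempNormallyTerminal ∧
      X.PiTempDenseDOFConjugator ∧ X.DeltaTempDenseDOFConjugator := by
  obtain ⟨X, hT, hsc, hnc, htower⟩ := exists_temperedCurve_isTempered_secondCountable_tower p
  haveI := hsc
  exact ⟨X, hnc, X.isOpenMap_aug_of_isTempered hT, X.ker_augHat_eq_deltaHat_of_isTempered hT,
    X.isProfiniteCompletion_deltaToHat_of_isTempered hT,
    X.deltaTempNormallyTerminal_of_isTempered hT htower, X.piTempNormallyTerminal_of_tower hT htower,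
    X.piTempDenseDOFConjugator_of_tower hT htower,
    X.deltaTempDenseDOFConjugator_of_isTempered hT htower⟩

/-- The `Δ^temp`-tower form at the witness: the André tower input DERIVED for `Δ^temp_X`
(abc-iut-w5-d139's `deltaTemp_tower_of_tower_of_isTempered`) is inhabited jointly with the interface.
[cite: MochizukiSemiAnbd2006, §6 p.69] -/
theorem exists_temperedCurve_deltaTemp_tower :
    ∃ X : TemperedCurve p, ¬ CompactSpace X.PiTemp ∧
      ∀ U ∈ 𝓝 (1 : X.DeltaTemp), ∃ N : OpenNormalSubgroup X.DeltaTemp, (N : Set X.DeltaTemp) ⊆ U ∧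
        ∃ (G : Subgroup (X.DeltaTemp ⧸ N.toSubgroup)) (_ : IsFreeGroup G), G.Normal ∧ G.FiniteIndex ∧
          Finite (IsFreeGroup.Generators G) ∧ ∃ a ∈ G, ∃ b ∈ G, a * b ≠ b * a := by
  obtain ⟨X, hT, hsc, hnc, htower⟩ := exists_temperedCurve_isTempered_secondCountable_tower p
  haveI := hsc
  exact ⟨X, hnc, X.deltaTemp_tower_of_tower_of_isTempered hT htower⟩

end Curve

end Literature.AnabelianGeometry.SemiGraphs

end
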